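import Summits.QuantumFields.BalabanUV.T4Continuum.Support.SubstrateTransporterSpeciesHolo

/-!
# SUBSTRATE — [dict] D-8 (v) «S-BG ON THE CHART», DISPLAYED INTERFACE ONLY: a holomorphic FAMILY of complex two-sided tower data
# `ξ ↦ (uC ξ, uCinv ξ)` through the real background of record at `ξ = 0`, and the covariance species read ALONG it (MAP v0.6 §O1 D-8 (v),
# typer sketch v0.6 §BGC; NE9 owner g31 consent l.15283 — «curve family, not object»; construction = [I] Lemma 4 p. 280, a T-row, NEVER substrate)

Cell `pub-balaban`, SUBSTRATE cell, seat `b2b-balaban-substrate-p1` (gen 2; typer NEXT gen 6 item 0).  Summits-side under the LEAN PLACEMENT RULE.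
HONEST FRAMING: rung (B)+1 of the FINITE-VOLUME T⁴ programme — NOT infinite volume, NOT a mass gap, NOT Clay; spine PROVED 0∕9; NE9 NOT proved.
TYPING + CALCULUS GLUE ONLY: NOTHING here constructs a complex background; the structure DISPLAYS what the species-(a) slice curves of [II]
(1.23) (`σ′ ↦ U_k(□₀, e^{iσ′B}·V)`, the background functional on COMPLEXIFIED configurations) must supply, and the lemmas say that the
two-sided species of `SubstrateTransporterSpecies` read along such a family are ℂ-differentiable off the singular set of `deltaQT` — by the
§2 calculus of `SubstrateTransporterSpeciesHolo` (p221143) BY NAME.  S-BG of record stays the REAL V1 background (`SubstrateBackground*`).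
Printed warrant for the READING (KIND only, nothing asserted): [Balaban1987RG1] Lemma 4 p. 280 (analytic dependence of the background on the
configuration), (1.18) p. 263; [Balaban1985BackgroundPropagators] Sect. B pp. 399–400 «U′U, U′ = e^{iηA}» with values in Gᶜ (as p220490's
`expChart` docstring).
HONEST DEPENDENCY (cell line, verbatim): continuum YM on T⁴ ⇐ BetaPertH ∧ nine spine estimates (0/9 proved); BetaPertH ⇐ (D1) ∧ (D4) ∧
CAP+tail; G-an2-4 gates asym, D1 and NE2/3/4.

WHAT (PAIR FORM — the D-8 pair typing `(R, S)`, `S ≙ U⁻¹`, no variable inverted inside the species).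
* §1 `ComplexBackgroundFamily P Ξ R0 ρ`: fields `uC uCinv : Ξ → TowerData P o`, centre clauses `uC 0 = R0`, `uCinv 0 = (R0)⁻¹` (pointwise),
  entrywise `DifferentiableOn ℂ` of both on `Metric.ball 0 ρ` (typer's three fields + the S-side member, so that Holo §2 composes BY NAME);
  constructors: `const` (invertible-free: non-vacuity of the TYPE), **`ofInvertible`** (ONE holomorphic family, invertible on the ball ⇒ `uCinv := `
  pointwise inverse, holomorphic by `differentiableOn_matrix_inv` — the Gᶜ-valued reading), **`ofChart`** (chart coordinates `A : Ξ → TowerData`,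
  `A 0 = 0` ⇒ `(expChartT P R0 ∘ A, expChartInvT P R0 ∘ A)`).
* §2 the species along the family: `regularAt F k := {ξ | IsUnit (deltaQT … (F.uC ξ k) (F.uCinv ξ k)).det}`, `regular F := ⋂ₖ regularAt F k`,
  `isOpen_ball_inter_regular`, `zero_mem_regularAt_iff` ∕ `zero_mem_regular_of_isUnit`, **`differentiableOn_unitCovT_family`**, **`differentiableOn_covAtT_family`** (on `ball 0 ρ ∩
  regular F`), **`exists_ball_differentiableOn_covAtT_family`** (`0 < ρ` + regular centre ⇒ a ball of holomorphy — NE9's `analyticClass` shape),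
  `covAtT_family_zero` ∕ **`covAtOfRecord_eq_covAtT_family_zero`** (the centre reads the record, unitary `ι`).
Imports p221143 only; modifies nothing.  v1.0.1 (DOCFIX-LOW ×2 of the XREAD of record, ne9-leaf-03-g15 l.15739; code byte-identical): the [B9] p. 400
locution and the §2 lemma names in this header corrected.  Level-lettered sequel: `SubstrateComplexBackgroundLev` (p223543).
-/

noncomputable section

open scoped BigOperators Matrix Matrix.Norms.L2Operator

namespace Summit.QuantumFields.BalabanUV.T4Continuum.SubstrateComplexBackground

open Literature.MathematicalPhysics.QuantumFieldTheory.Balaban1983to89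
open Literature.MathematicalPhysics.QuantumFieldTheory.Balaban1983to89.B5Prop11Plancherel (Tor fine)
open Literature.MathematicalPhysics.QuantumFieldTheory.Balaban1983to89.B5G183RateUnitTower (lev lev_neZero)
open Summit.QuantumFields.BalabanUV.T4Continuum.CovariantBlockAveraging (ContourSystem)
open Summit.QuantumFields.BalabanUV.T4Continuum.SubstrateBackgroundTransporters
open Summit.QuantumFields.BalabanUV.T4Continuum.SubstrateTransporterSpecies
open Summit.QuantumFields.BalabanUV.T4Continuum.SubstrateTransporterSpeciesHolo

variable (P : Params) {o : Type*} [Fintype o] [DecidableEq o]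

/-! ## §1 The displayed interface -/

/-- [folklore] HYPOTHESIS STRUCTURE **`ComplexBackgroundFamily P Ξ R0 ρ`** over a complex parameter space `Ξ` (where the species-(a) slice
parameter lives): the background tower as TWO-SIDED complex transporter data `(uC ξ, uCinv ξ)` («U, U⁻¹» of the Gᶜ-valued reading), passing
through the real background of record and its inverse at the centre `ξ = 0`, holomorphic matrix entry by matrix entry on the ball of radius `ρ`.
Nothing constructs `uC`; S-BG of record stays the real V1 background ([Balaban1987RG1] Lemma 4 p. 280 is the T-row that would inhabit it). -/
structure ComplexBackgroundFamily (Ξ : Type*) [NormedAddCommGroup Ξ] [NormedSpace ℂ Ξ] (R0 : TowerData P o) (ρ : ℝ) where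
  /-- the background tower on complex configuration data (the `R`-side, «U») -/
  uC : Ξ → TowerData P o
  /-- its two-sided partner (the `S`-side, «U⁻¹») -/
  uCinv : Ξ → TowerData P o
  /-- centre clause: at `ξ = 0` the real background of record -/
  uC_zero : uC 0 = R0
  /-- centre clause for the partner: the pointwise inverse of the background of record -/
  uCinv_zero : uCinv 0 = fun k ν b => (R0 k ν b)⁻¹
  /-- holomorphy of the `R`-side on the ball, per (level, direction, bond) matrix -/
  differentiableOn : ∀ (k : Fin (P.K + 1)) (ν : Fin P.d) (b : Tor (fine (lev P.L k) (unitMod P)) × Fin P.d),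
    DifferentiableOn ℂ (fun ξ => uC ξ k ν b) (Metric.ball (0 : Ξ) ρ)
  /-- holomorphy of the `S`-side on the ball -/
  differentiableOn_inv : ∀ (k : Fin (P.K + 1)) (ν : Fin P.d) (b : Tor (fine (lev P.L k) (unitMod P)) × Fin P.d),
    DifferentiableOn ℂ (fun ξ => uCinv ξ k ν b) (Metric.ball (0 : Ξ) ρ)

namespace ComplexBackgroundFamily

variable {P}
variable {Ξ : Type*} [NormedAddCommGroup Ξ] [NormedSpace ℂ Ξ]

/-- [folklore] The CONSTANT family `(R0, R0⁻¹)` inhabits the interface — non-vacuity of the TYPE only. -/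
def const (R0 : TowerData P o) (ρ : ℝ) : ComplexBackgroundFamily P Ξ R0 ρ where
  uC := fun _ => R0
  uCinv := fun _ k ν b => (R0 k ν b)⁻¹
  uC_zero := rfl
  uCinv_zero := rfl
  differentiableOn := fun _ _ _ => differentiableOn_const _
  differentiableOn_inv := fun _ _ _ => differentiableOn_const _

/-- [folklore] **THE Gᶜ-VALUED READING**: ONE holomorphic family of tower data through `R0`, INVERTIBLE on the ball (values in the complexified
group), gives a two-sided family with partner the pointwise inverse — holomorphic by `differentiableOn_matrix_inv` (p221143 §1). -/
def ofInvertible (R0 : TowerData P o) (ρ : ℝ) (uC : Ξ → TowerData P o) (h0 : uC 0 = R0)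
    (hd : ∀ (k : Fin (P.K + 1)) ν b, DifferentiableOn ℂ (fun ξ => uC ξ k ν b) (Metric.ball (0 : Ξ) ρ))
    (hu : ∀ ξ ∈ Metric.ball (0 : Ξ) ρ, ∀ (k : Fin (P.K + 1)) ν b, IsUnit (uC ξ k ν b).det) : ComplexBackgroundFamily P Ξ R0 ρ where
  uC := uC
  uCinv := fun ξ k ν b => (uC ξ k ν b)⁻¹
  uC_zero := h0
  uCinv_zero := by funext k ν b; rw [h0]
  differentiableOn := hd
  differentiableOn_inv := fun k ν b => differentiableOn_matrix_inv (hd k ν b) fun ξ hξ => hu ξ hξ k ν b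

/-- [folklore] **CHART-COORDINATE FAMILIES**: holomorphic chart coordinates `A : Ξ → TowerData P o` with `A 0 = 0` give the two-sided family
`(expChartT P R0 (A ξ), expChartInvT P R0 (A ξ))` (the chart is entire — `differentiable_expChart(Inv)` of p221143 §3; no invertibility needed). -/
def ofChart (R0 : TowerData P o) (ρ : ℝ) (A : Ξ → TowerData P o) (hA0 : A 0 = 0)
    (hA : ∀ (k : Fin (P.K + 1)) ν b, DifferentiableOn ℂ (fun ξ => A ξ k ν b) (Metric.ball (0 : Ξ) ρ)) : ComplexBackgroundFamily P Ξ R0 ρ where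
  uC := fun ξ => expChartT P R0 (A ξ)
  uCinv := fun ξ => expChartInvT P R0 (A ξ)
  uC_zero := by rw [hA0, expChartT_zero]
  uCinv_zero := by rw [hA0, expChartInvT_zero]
  differentiableOn := fun k ν b =>
    (differentiable_expChart (R0 k) ν b).comp_differentiableOn (differentiableOn_pi.2 fun ν => differentiableOn_pi.2 fun b => hA k ν b)
  differentiableOn_inv := fun k ν b =>
    (differentiable_expChartInv (R0 k) ν b).comp_differentiableOn (differentiableOn_pi.2 fun ν => differentiableOn_pi.2 fun b => hA k ν b)

/-- [folklore] `ofChart` reads the chart levelwise (rfl view). -/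
theorem ofChart_uC (R0 : TowerData P o) (ρ : ℝ) (A : Ξ → TowerData P o) (hA0 : A 0 = 0)
    (hA : ∀ (k : Fin (P.K + 1)) ν b, DifferentiableOn ℂ (fun ξ => A ξ k ν b) (Metric.ball (0 : Ξ) ρ)) (ξ : Ξ) :
    (ofChart R0 ρ A hA0 hA).uC ξ = expChartT P R0 (A ξ) ∧ (ofChart R0 ρ A hA0 hA).uCinv ξ = expChartInvT P R0 (A ξ) := ⟨rfl, rfl⟩

/-! ## §2 The covariance species along a complex background family -/

variable {R0 : TowerData P o} {ρ : ℝ} (c : ℂ) (a : ℝ) (Γ : (k : ℕ) → ContourSystem P.d (lev P.L k) (unitMod P))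
  (F : ComplexBackgroundFamily P Ξ R0 ρ)

/-- [folklore] The level-`k` REGULAR PARAMETERS of the family: where the level-`k` two-sided fluctuation operator along it is invertible. -/
def regularAt (k : Fin (P.K + 1)) : Set Ξ := {ξ | IsUnit (deltaQT (lev P.L k) (unitMod P) c a (Γ k) (F.uC ξ k) (F.uCinv ξ k)).det}

/-- [folklore] The REGULAR PARAMETERS: regular at every NE2 level `k ≤ K`. -/
def regular : Set Ξ := ⋂ k, regularAt c a Γ F k

/-- [folklore] The level-`k` fluctuation operator along the family is ℂ-differentiable on the ball (polynomial in differentiable data). -/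
theorem differentiableOn_deltaQT_family (k : Fin (P.K + 1)) :
    DifferentiableOn ℂ (fun ξ => deltaQT (lev P.L k) (unitMod P) c a (Γ k) (F.uC ξ k) (F.uCinv ξ k)) (Metric.ball (0 : Ξ) ρ) :=
  differentiableOn_deltaQT (lev P.L k) (unitMod P) (fun ν b => F.differentiableOn k ν b) (fun ν b => F.differentiableOn_inv k ν b) c a (Γ k)

/-- [folklore] The regular parameters inside the ball form an OPEN set (continuity of the determinant on the ball). -/
theorem isOpen_ball_inter_regularAt (k : Fin (P.K + 1)) : IsOpen (Metric.ball (0 : Ξ) ρ ∩ regularAt c a Γ F k) := by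
  have hc0 := (differentiableOn_deltaQT_family c a Γ F k).continuousOn
  have hc : ContinuousOn (fun ξ => (deltaQT (lev P.L k) (unitMod P) c a (Γ k) (F.uC ξ k) (F.uCinv ξ k)).det) (Metric.ball (0 : Ξ) ρ) := by
    rw [continuousOn_iff_continuous_restrict] at hc0 ⊢
    exact hc0.matrix_det
  have h := hc.isOpen_inter_preimage Metric.isOpen_ball (isOpen_compl_singleton (x := (0 : ℂ)))
  convert h using 1
  ext ξ
  simp only [regularAt, isUnit_iff_ne_zero, Set.mem_inter_iff, Set.mem_setOf_eq, Set.mem_preimage, Set.mem_compl_iff,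
    Set.mem_singleton_iff]

/-- [folklore] … and so do the parameters regular at every level. -/
theorem isOpen_ball_inter_regular : IsOpen (Metric.ball (0 : Ξ) ρ ∩ regular c a Γ F) := by
  have h : Metric.ball (0 : Ξ) ρ ∩ regular c a Γ F = ⋂ k, (Metric.ball (0 : Ξ) ρ ∩ regularAt c a Γ F k) := by
    ext ξ; simp only [regular, Set.mem_inter_iff, Set.mem_iInter]; exact ⟨fun h k => ⟨h.1, h.2 k⟩, fun h => ⟨(h 0).1, fun k => (h k).2⟩⟩
  rw [h]
  exact isOpen_iInter_of_finite fun k => isOpen_ball_inter_regularAt c a Γ F k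

/-- [folklore] The centre is level-`k` regular iff the operator at `(R0 k, (R0 k)⁻¹)` is invertible — the SAME condition as for the chart
(`SubstrateTransporterSpeciesHolo.zero_mem_regularSetAt_iff`), discharged at regular backgrounds on the J-road. -/
theorem zero_mem_regularAt_iff (k : Fin (P.K + 1)) :
    (0 : Ξ) ∈ regularAt c a Γ F k ↔ IsUnit (deltaQT (lev P.L k) (unitMod P) c a (Γ k) (R0 k) (fun ν b => (R0 k ν b)⁻¹)).det := by
  simp only [regularAt, Set.mem_setOf_eq, F.uC_zero, F.uCinv_zero]

/-- [folklore] A centre regular at every level lies in `regular`. -/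
theorem zero_mem_regular_of_isUnit (h : ∀ k : Fin (P.K + 1), IsUnit (deltaQT (lev P.L k) (unitMod P) c a (Γ k) (R0 k) (fun ν b => (R0 k ν b)⁻¹)).det) :
    (0 : Ξ) ∈ regular c a Γ F :=
  Set.mem_iInter.2 fun k => (zero_mem_regularAt_iff c a Γ F k).2 (h k)

/-- [folklore] **THE LEVEL-`k` TWO-SIDED COVARIANCE ALONG THE FAMILY IS ℂ-DIFFERENTIABLE on the regular part of the ball** (Holo §2 BY NAME). -/
theorem differentiableOn_unitCovT_family (k : Fin (P.K + 1)) (sc : ℂ) :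
    DifferentiableOn ℂ (fun ξ => unitCovT (lev P.L k) (unitMod P) c a sc (Γ k) (F.uC ξ k) (F.uCinv ξ k))
      (Metric.ball (0 : Ξ) ρ ∩ regularAt c a Γ F k) :=
  differentiableOn_unitCovT (lev P.L k) (unitMod P) (fun ν b => (F.differentiableOn k ν b).mono Set.inter_subset_left)
    (fun ν b => (F.differentiableOn_inv k ν b).mono Set.inter_subset_left) (fun _ hξ => hξ.2) sc

variable (s : ℕ → ℂ)

/-- [folklore] **THE COVARIANCE FAMILY `covAtT` ALONG A COMPLEX BACKGROUND FAMILY IS ℂ-DIFFERENTIABLE** — every level (levels `> K` read `0`),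
slot and entry — on the regular part of the ball. -/
theorem differentiableOn_covAtT_family (k : ℕ) {T : Type*} (t : T) (b b' : (Tor (unitMod P) × Fin P.d) × o) :
    DifferentiableOn ℂ (fun ξ => covAtT P c a s Γ (F.uC ξ) (F.uCinv ξ) k t b b') (Metric.ball (0 : Ξ) ρ ∩ regular c a Γ F) := by
  unfold covAtT
  by_cases hk : k ≤ P.K
  · simp only [dif_pos hk]
    exact (differentiableOn_matrix_iff.1 (differentiableOn_unitCovT_family c a Γ F ⟨k, Nat.lt_succ_of_le hk⟩ (s k)) b b').mono
      (Set.inter_subset_inter_right _ (Set.iInter_subset _ _))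
  · simp only [dif_neg hk]
    exact differentiableOn_const _

/-- [folklore] **THE BALL FORM** (NE9's `analyticClass` shape): for `0 < ρ` and a centre regular at every level there is `ρ′ > 0` such that every
entry of `covAtT` along the family is ℂ-differentiable on `ball 0 ρ′` (openness; `ρ′` NOT computed). -/
theorem exists_ball_differentiableOn_covAtT_family (hρ : 0 < ρ)
    (h0 : ∀ k : Fin (P.K + 1), IsUnit (deltaQT (lev P.L k) (unitMod P) c a (Γ k) (R0 k) (fun ν b => (R0 k ν b)⁻¹)).det) :
    ∃ ρ' > 0, ∀ (k : ℕ) {T : Type*} (t : T) (b b' : (Tor (unitMod P) × Fin P.d) × o),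
      DifferentiableOn ℂ (fun ξ => covAtT P c a s Γ (F.uC ξ) (F.uCinv ξ) k t b b') (Metric.ball (0 : Ξ) ρ') := by
  have hmem : (0 : Ξ) ∈ Metric.ball (0 : Ξ) ρ ∩ regular c a Γ F := ⟨Metric.mem_ball_self hρ, zero_mem_regular_of_isUnit c a Γ F h0⟩
  obtain ⟨ρ', hρ', hsub⟩ := Metric.isOpen_iff.1 (isOpen_ball_inter_regular c a Γ F) 0 hmem
  exact ⟨ρ', hρ', fun k _ t b b' => (differentiableOn_covAtT_family c a Γ F s k t b b').mono hsub⟩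

/-- [folklore] **THE CENTRE OF THE FAMILY READS THE TWO-SIDED FAMILY AT `(R0, R0⁻¹)`.** -/
theorem covAtT_family_zero (k : ℕ) {T : Type*} (t : T) (b b' : (Tor (unitMod P) × Fin P.d) × o) :
    covAtT P c a s Γ (F.uC 0) (F.uCinv 0) k t b b' = covAtT P c a s Γ R0 (fun k ν b => (R0 k ν b)⁻¹) k t b b' := by
  rw [F.uC_zero, F.uCinv_zero]

variable {G : Type*} [GaugeGroup G] (ι : G →* Matrix o o ℂ) (av : ∀ j, Averaging P j G)

/-- [folklore] **THE CENTRE READS THE RECORD**: for a family centred at the tower data of record `towerDataOf P ι av U` (unitary-valued `ι`) the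
covariance family OF RECORD at `U` is the family-read two-sided covariance at `ξ = 0` (p220490 `covAtOfRecord_eq_covAtT` + `adjOf_eq_inv`). -/
theorem covAtOfRecord_eq_covAtT_family_zero (hι : ∀ g, ι g ∈ Matrix.unitaryGroup o ℂ) (U : GaugeField P 0 G) {ρ : ℝ}
    (F : ComplexBackgroundFamily P Ξ (towerDataOf P ι av U) ρ) (k : ℕ) {T : Type*} (t : T) (b b' : (Tor (unitMod P) × Fin P.d) × o) :
    SubstrateRawSpecies.covAtOfRecord P ι av c a s Γ U k t b b' = covAtT P c a s Γ (F.uC 0) (F.uCinv 0) k t b b' := by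
  rw [covAtT_family_zero, covAtOfRecord_eq_covAtT]
  have h : (fun k => adjOf (towerDataOf P ι av U k)) = fun k ν i => (towerDataOf P ι av U k ν i)⁻¹ :=
    funext fun k => adjOf_eq_inv fun ν i => transV_mem_unitaryGroup _ hι _ ν i
  rw [h]

end ComplexBackgroundFamily

end Summit.QuantumFields.BalabanUV.T4Continuum.SubstrateComplexBackground

end
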